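import Summits.Ventures.WeilGRH.TwistedGramEvenReal
import HarnessLib

/-!
# GRH arm (rh-explicit, venture WeilGRH): the `sech` density of the parity bonus and the twisted window form of
  an ODD REAL character on window functions

Cell `rh-explicit`, WEIL TRACK — GRH ARM (typing seat weil-grh-1).  Sequel of `TwistedGramEvenReal.lean`; first
half of the odd-real-character entry theorem (`TwistedGramOddReal.lean`).  For a character of ODD parity the
archimedean density is `ρ₁ = ρ₀ − σ`, `σ(t) = 1/(2cosh(t/2))` (`weilArchDensityPar_one_eq`; cf.
`WeilExplicitArchParitySech.lean`: the parity term is the `sech` kernel), with `∫_c^∞ σ = π − 2arctan(e^{c/2})`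
(`integral_sech_density_Ioi`), `∫₀^∞ σ = π/2`.  Hence for a REAL character with `a_χ = 1` and a window
function `u`:

  `𝓔^χ_a(u) − M^χ_a‖u‖₂² = [weilWindowForm a u − P(u)] + Σ_{log k<2a}(χ(k) − 1)Λ(k)k^{-1/2}(D_{log k}(u) − 2‖u‖₂²)`
      `+ (log q)‖u‖₂² + (π‖u‖₂² − ∫₀^∞ σ(t) D_t(u) dt)`          (`twistedWindowForm_eq_of_odd_real`)

— the even-real expression plus the PARITY BONUS `π‖u‖₂² − ∫₀^∞ σ D_t(u)`.  Also the parity-free core on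
trigonometric windows: `core_sum_smul_chi_eq_twistedGramCoeff` (the even-real corrections as the Hermitian form
of `twistedGramCoeff χ a`, for ANY `χ`).  No new definitions; no named facts; RH/GRH-free.
-/

set_option autoImplicit false

noncomputable section

open Complex Filter Set MeasureTheory
open scoped Real Topology ComplexConjugate ArithmeticFunction.vonMangoldt

namespace Summit.Ventures.WeilGRH

open Literature.NumberTheory.LFunctions
open Literature.NumberTheory.LFunctions.Yoshida1992 (modes chi freq gramCoeff polarCoeff incrCoeff)
open Summit.RiemannHypothesis.RiemannHypothesis.Theorems.WeilFormatC

variable {q : ℕ} {a S Le : ℝ} {u : ℝ → ℂ}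


/-! ## The `sech` density `σ(t) = 1/(2cosh(t/2))` -/

/-- `σ(t) = 1/(2cosh(t/2)) > 0`. -/
theorem sech_density_pos (t : ℝ) : 0 < 1 / (2 * Real.cosh (t / 2)) := by
  have := Real.cosh_pos (t / 2); positivity

/-- `σ(t) ≤ e^{−t/2}` (`2cosh(t/2) ≥ e^{t/2}`). -/
theorem sech_density_le_exp_neg (t : ℝ) : 1 / (2 * Real.cosh (t / 2)) ≤ Real.exp (-(1 / 2) * t) := by
  have hc : Real.exp (t / 2) ≤ 2 * Real.cosh (t / 2) := by
    rw [Real.cosh_eq]; linarith [Real.exp_pos (-(t / 2))]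
  rw [div_le_iff₀ (by have := Real.cosh_pos (t / 2); positivity)]
  calc (1 : ℝ) = Real.exp (-(1 / 2) * t) * Real.exp (t / 2) := by
          rw [← Real.exp_add, show -(1 / 2) * t + t / 2 = (0 : ℝ) by ring, Real.exp_zero]
    _ ≤ Real.exp (-(1 / 2) * t) * (2 * Real.cosh (t / 2)) :=
        mul_le_mul_of_nonneg_left hc (Real.exp_pos _).le

/-- `σ` is continuous. -/
theorem continuous_sech_density : Continuous fun t : ℝ ↦ 1 / (2 * Real.cosh (t / 2)) :=
  Continuous.div continuous_const (by fun_prop) fun t ↦ by have := Real.cosh_pos (t / 2); positivity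

/-- `σ` is integrable on every `(c, ∞)`. -/
theorem integrableOn_sech_density_Ioi (c : ℝ) :
    IntegrableOn (fun t : ℝ ↦ 1 / (2 * Real.cosh (t / 2))) (Ioi c) := by
  refine Integrable.mono' (exp_neg_integrableOn_Ioi c (by norm_num : (0 : ℝ) < 1 / 2))
    continuous_sech_density.aestronglyMeasurable.restrict ?_
  refine (ae_restrict_iff' measurableSet_Ioi).2 (Eventually.of_forall fun t _ ↦ ?_)
  rw [Real.norm_of_nonneg (sech_density_pos t).le]
  exact sech_density_le_exp_neg t

/-- **`∫_c^∞ σ = π − 2 arctan(e^{c/2})`** (antiderivative `2 arctan(e^{t/2})`). -/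
theorem integral_sech_density_Ioi (c : ℝ) :
    ∫ t in Ioi c, 1 / (2 * Real.cosh (t / 2)) = π - 2 * Real.arctan (Real.exp (c / 2)) := by
  have hderiv : ∀ t : ℝ, HasDerivAt (fun t : ℝ ↦ 2 * Real.arctan (Real.exp (t / 2)))
      (1 / (2 * Real.cosh (t / 2))) t := by
    intro t
    have h1 : HasDerivAt (fun t : ℝ ↦ Real.exp (t / 2)) (Real.exp (t / 2) * (1 / 2)) t := by
      simpa using ((hasDerivAt_id t).div_const 2).exp
    have h2 := ((Real.hasDerivAt_arctan (Real.exp (t / 2))).comp t h1).const_mul 2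
    have hE0 : Real.exp (t / 2) ≠ 0 := (Real.exp_pos _).ne'
    have hval : 2 * (1 / (1 + Real.exp (t / 2) ^ 2) * (Real.exp (t / 2) * (1 / 2))) =
        1 / (2 * Real.cosh (t / 2)) := by
      rw [Real.cosh_eq, Real.exp_neg]
      field_simp
      ring
    rw [← hval]
    exact h2
  have hlim : Tendsto (fun t : ℝ ↦ 2 * Real.arctan (Real.exp (t / 2))) atTop (𝓝 π) := by
    have h1 : Tendsto (fun t : ℝ ↦ Real.exp (t / 2)) atTop atTop :=
      Real.tendsto_exp_atTop.comp (tendsto_id.atTop_div_const (by norm_num))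
    have h2 : Tendsto (fun t : ℝ ↦ Real.arctan (Real.exp (t / 2))) atTop (𝓝 (π / 2)) :=
      (Real.tendsto_arctan_atTop.mono_right nhdsWithin_le_nhds).comp h1
    have h3 := h2.const_mul 2
    rw [show 2 * (π / 2) = π by ring] at h3
    exact h3
  rw [integral_Ioi_of_hasDerivAt_of_tendsto (hderiv c).continuousAt.continuousWithinAt
    (fun t _ ↦ hderiv t) (integrableOn_sech_density_Ioi c) hlim]

/-- `∫_0^∞ σ = π/2`. -/
theorem integral_sech_density_Ioi_zero : ∫ t in Ioi (0 : ℝ), 1 / (2 * Real.cosh (t / 2)) = π / 2 := by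
  rw [integral_sech_density_Ioi, zero_div, Real.exp_zero, Real.arctan_one]; ring

/-- **The odd density is the even one minus `σ`**: `ρ₁(t) = ρ₀(t) − 1/(2cosh(t/2))` for `t ≠ 0`. -/
theorem weilArchDensityPar_one_eq {t : ℝ} (ht : t ≠ 0) :
    weilArchDensityPar 1 t = weilArchDensity t - 1 / (2 * Real.cosh (t / 2)) := by
  have hs : Real.sinh t ≠ 0 := by
    rw [ne_eq, Real.sinh_eq_zero]; exact ht
  have hc : Real.cosh (t / 2) ≠ 0 := (Real.cosh_pos _).ne'
  have key : (Real.exp (t / 2) - Real.exp (-(t / 2))) * (2 * Real.cosh (t / 2)) = 2 * Real.sinh t := by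
    have h1 : Real.exp (t / 2) - Real.exp (-(t / 2)) = 2 * Real.sinh (t / 2) := by
      rw [Real.sinh_eq]; ring
    rw [h1, show t = 2 * (t / 2) by ring, Real.sinh_two_mul]; ring_nf
  have h2s : 2 * Real.sinh t ≠ 0 := mul_ne_zero two_ne_zero hs
  have h2c : 2 * Real.cosh (t / 2) ≠ 0 := mul_ne_zero two_ne_zero hc
  have hσ : 1 / (2 * Real.cosh (t / 2)) = (Real.exp (t / 2) - Real.exp (-(t / 2))) / (2 * Real.sinh t) := by
    rw [div_eq_div_iff h2c h2s, one_mul, key]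
  unfold weilArchDensityPar weilArchDensity
  rw [show ((1 : ℝ) / 2 - ((1 : ℕ) : ℝ)) * t = -(t / 2) by push_cast; ring, hσ, div_sub_div_same]
  congr 1
  ring

/-- The odd killing density likewise: `(e^{−t/2} − 1)/(2 sinh t) = (e^{t/2} − 1)/(2 sinh t) − 1/(2cosh(t/2))`, `t ≠ 0`. -/
theorem weilKillingDensityPar_one_eq {t : ℝ} (ht : t ≠ 0) :
    weilKillingDensityPar 1 t = (Real.exp (t / 2) - 1) / (2 * Real.sinh t) - 1 / (2 * Real.cosh (t / 2)) := by
  have h := weilArchDensityPar_one_eq ht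
  unfold weilArchDensityPar weilArchDensity at h
  unfold weilKillingDensityPar
  rw [show ((1 : ℝ) / 2 - ((1 : ℕ) : ℝ)) * t = -(t / 2) by push_cast; ring] at h ⊢
  rw [sub_div, sub_div, h]
  ring

/-! ## The window-level identity for an odd real character -/

/-- A real character takes real values. -/
private theorem conj_eq_ofReal_re'' {z : ℂ} (h : conj z = z) : conj z = ((z.re : ℝ) : ℂ) := by
  rw [h]; exact (Complex.conj_eq_iff_re.1 h).symm

/-- For a real value, `‖z‖² = (Re z)²`. -/
private theorem norm_sq_eq_re_sq' {z : ℂ} (h : conj z = z) : ‖z‖ ^ 2 = z.re ^ 2 := by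
  rw [← Complex.conj_eq_iff_re.1 h, Complex.norm_real, Real.norm_eq_abs, sq_abs, Complex.ofReal_re]

/-- `t ↦ σ(t) D_t(u)` is integrable on `(0, ∞)` for a bounded measurable `u` vanishing off `[-a,a]`
(`D_t(u) ≤ 4‖u‖… ≤` a constant, `σ ≤ e^{−t/2}`). -/
theorem integrableOn_sech_mul_weilIncrement (ha : 0 ≤ a) (hm : Measurable u)
    (hz : ∀ x, x ∉ Icc (-a) a → u x = 0) (hb : ∀ x, ‖u x‖ ≤ S) :
    IntegrableOn (fun t ↦ 1 / (2 * Real.cosh (t / 2)) * weilIncrement u t) (Ioi 0) := by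
  have hD : ∀ t, weilIncrement u t ≤ 8 * a * S ^ 2 := fun t ↦ weilIncrement_le_window_const ha hm hz hb t
  refine Integrable.mono' ((integrableOn_sech_density_Ioi 0).mul_const (8 * a * S ^ 2))
    ((continuous_sech_density.measurable.mul (measurable_weilIncrement hm)).aestronglyMeasurable) ?_
  refine (ae_restrict_iff' measurableSet_Ioi).2 (Eventually.of_forall fun t _ ↦ ?_)
  have h0 := sech_density_pos t
  rw [Real.norm_of_nonneg (mul_nonneg h0.le (weilIncrement_nonneg _ _))]
  exact mul_le_mul_of_nonneg_left (hD t) h0.le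

/-- **The twisted window form of an ODD REAL character**: for `conj χ = χ`, `a_χ = 1`, `0 ≤ a` and a window
function `u` (measurable, `0` off `[-a,a]`, bounded, Lipschitz on the window),
`𝓔^χ_a(u) − M^χ_a‖u‖₂² = weilWindowForm a u − P(u) + Σ_{log k<2a}(χ(k) − 1)Λ(k)k^{-1/2}(D_{log k}(u) − 2‖u‖₂²)`
`+ (log q)‖u‖₂² + (π‖u‖₂² − ∫₀^∞ D_t(u) dt/(2cosh(t/2)))`. -/
theorem twistedWindowForm_eq_of_odd_real (χ : DirichletCharacter ℂ q)
    (hχ : ∀ n : ℕ, conj (χ (n : ZMod q)) = χ (n : ZMod q)) (hodd : charParity χ = 1) (ha : 0 ≤ a)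
    (hm : Measurable u) (hz : ∀ x, x ∉ Icc (-a) a → u x = 0) (hb : ∀ x, ‖u x‖ ≤ S)
    (hl : ∀ x y, x ∈ Icc (-a) a → y ∈ Icc (-a) a → ‖u y - u x‖ ≤ Le * |y - x|) :
    weilDirichletEnergyChar χ a u - weilMarkovConstantChar χ a * ∫ x, ‖u x‖ ^ 2 =
      weilWindowForm a u - weilPoleForm u +
        (∑ k ∈ weilPrimeIndex a, ((χ (k : ZMod q)).re - 1) * ((Λ k : ℝ) / Real.sqrt k) *
          (weilIncrement u (Real.log k) - 2 * ∫ x, ‖u x‖ ^ 2)) +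
        Real.log q * (∫ x, ‖u x‖ ^ 2) +
        (π * (∫ x, ‖u x‖ ^ 2) - ∫ t in Ioi (0 : ℝ), 1 / (2 * Real.cosh (t / 2)) * weilIncrement u t) := by
  have htw : ∀ k : ℕ, weilTwistIncrement (conj (χ (k : ZMod q))) u (Real.log k) =
      (χ (k : ZMod q)).re * weilIncrement u (Real.log k) +
        (1 - (χ (k : ZMod q)).re) ^ 2 * ∫ x, ‖u x‖ ^ 2 := fun k ↦ by
    rw [conj_eq_ofReal_re'' (hχ k), weilTwistIncrement_ofReal hm hz hb]
  have hns : ∀ k : ℕ, ‖χ (k : ZMod q)‖ ^ 2 = (χ (k : ZMod q)).re ^ 2 := fun k ↦ norm_sq_eq_re_sq' (hχ k)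
  -- the odd archimedean energy and killing integral through the even ones
  have hIρ := integrableOn_weilArchDensity_mul_weilIncrement_window ha hm hz hb hl
  have hIσ := integrableOn_sech_mul_weilIncrement ha hm hz hb
  have harch : ∫ t in Ioi (0 : ℝ), weilArchDensityPar 1 t * weilIncrement u t =
      (∫ t in Ioi (0 : ℝ), weilArchDensity t * weilIncrement u t) -
        ∫ t in Ioi (0 : ℝ), 1 / (2 * Real.cosh (t / 2)) * weilIncrement u t := by
    rw [← integral_sub hIρ hIσ]
    refine setIntegral_congr_fun measurableSet_Ioi fun t (ht : 0 < t) ↦ ?_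
    rw [weilArchDensityPar_one_eq ht.ne', sub_mul]
  have hkill : ∫ t in Ioi (0 : ℝ), weilKillingDensityPar 1 t =
      (∫ t in Ioi (0 : ℝ), (Real.exp (t / 2) - 1) / (2 * Real.sinh t)) - π / 2 := by
    rw [← integral_sech_density_Ioi_zero, ← integral_sub integrableOn_weilKillingDensity
      (integrableOn_sech_density_Ioi 0)]
    exact setIntegral_congr_fun measurableSet_Ioi fun t (ht : 0 < t) ↦ weilKillingDensityPar_one_eq ht.ne'
  unfold weilDirichletEnergyChar weilMarkovConstantChar weilWindowForm weilDirichletEnergy weilMarkovConstant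
  rw [hodd, harch, hkill]
  simp_rw [htw, hns]
  set N2 : ℝ := ∫ x, ‖u x‖ ^ 2
  have h1 : ∑ k ∈ weilPrimeIndex a, (Λ k : ℝ) / Real.sqrt k *
      ((χ (k : ZMod q)).re * weilIncrement u (Real.log k) + (1 - (χ (k : ZMod q)).re) ^ 2 * N2) =
      (∑ k ∈ weilPrimeIndex a, (Λ k : ℝ) / Real.sqrt k * weilIncrement u (Real.log k)) +
        ∑ k ∈ weilPrimeIndex a, ((χ (k : ZMod q)).re - 1) * ((Λ k : ℝ) / Real.sqrt k) *
          (weilIncrement u (Real.log k) - 2 * N2) +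
        N2 * ∑ k ∈ weilPrimeIndex a, (Λ k : ℝ) / Real.sqrt k * (1 + (χ (k : ZMod q)).re ^ 2) -
        2 * N2 * ∑ k ∈ weilPrimeIndex a, (Λ k : ℝ) / Real.sqrt k := by
    rw [Finset.mul_sum, Finset.mul_sum, ← Finset.sum_add_distrib, ← Finset.sum_add_distrib,
      ← Finset.sum_sub_distrib]
    exact Finset.sum_congr rfl fun k _ ↦ by ring
  rw [h1]
  ring

/-! ## The parity-free core on the trigonometric windows -/

section Pairing

variable (s : Finset ℤ) (c : ℤ → ℂ)

/-- Linearity of the real pairing: sums. -/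
private theorem pair_add' (G H : ℤ → ℤ → ℝ) :
    ∑ n ∈ s, ∑ m ∈ s, (conj (c n) * c m).re * (G n m + H n m) =
      (∑ n ∈ s, ∑ m ∈ s, (conj (c n) * c m).re * G n m) +
        ∑ n ∈ s, ∑ m ∈ s, (conj (c n) * c m).re * H n m := by
  simp only [mul_add, Finset.sum_add_distrib]

/-- Linearity of the real pairing: differences. -/
private theorem pair_sub' (G H : ℤ → ℤ → ℝ) :
    ∑ n ∈ s, ∑ m ∈ s, (conj (c n) * c m).re * (G n m - H n m) =
      (∑ n ∈ s, ∑ m ∈ s, (conj (c n) * c m).re * G n m) -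
        ∑ n ∈ s, ∑ m ∈ s, (conj (c n) * c m).re * H n m := by
  simp only [mul_sub, Finset.sum_sub_distrib]

/-- Linearity of the real pairing: scalars. -/
private theorem pair_const_mul' (r : ℝ) (G : ℤ → ℤ → ℝ) :
    ∑ n ∈ s, ∑ m ∈ s, (conj (c n) * c m).re * (r * G n m) =
      r * ∑ n ∈ s, ∑ m ∈ s, (conj (c n) * c m).re * G n m := by
  rw [Finset.mul_sum]
  refine Finset.sum_congr rfl fun n _ ↦ ?_
  rw [Finset.mul_sum]
  exact Finset.sum_congr rfl fun m _ ↦ by ring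

/-- Linearity of the real pairing: finite sums of kernels. -/
private theorem pair_sum' (t : Finset ℕ) (G : ℕ → ℤ → ℤ → ℝ) :
    ∑ n ∈ s, ∑ m ∈ s, (conj (c n) * c m).re * (∑ k ∈ t, G k n m) =
      ∑ k ∈ t, ∑ n ∈ s, ∑ m ∈ s, (conj (c n) * c m).re * G k n m := by
  calc ∑ n ∈ s, ∑ m ∈ s, (conj (c n) * c m).re * ∑ k ∈ t, G k n m
      = ∑ n ∈ s, ∑ m ∈ s, ∑ k ∈ t, (conj (c n) * c m).re * G k n m := by
        simp only [Finset.mul_sum]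
    _ = ∑ n ∈ s, ∑ k ∈ t, ∑ m ∈ s, (conj (c n) * c m).re * G k n m :=
        Finset.sum_congr rfl fun n _ ↦ Finset.sum_comm
    _ = ∑ k ∈ t, ∑ n ∈ s, ∑ m ∈ s, (conj (c n) * c m).re * G k n m := Finset.sum_comm

end Pairing

/-- **The parity-free core on the trigonometric windows**: for ANY Dirichlet character `χ`, `a > 0`,
`[weilWindowForm a u − P(u)] + Σ_{log k<2a}(Re χ(k) − 1)Λ(k)k^{-1/2}(D_{log k}(u) − 2‖u‖₂²) + (log q)‖u‖₂²`
at `u = Σ c_nχ_n` equals `Σ_n Σ_m Re(conj c_n c_m)·twistedGramCoeff χ a n m`. -/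
theorem core_sum_smul_chi_eq_twistedGramCoeff (χ : DirichletCharacter ℂ q) (ha : 0 < a) (s : Finset ℤ)
    (c : ℤ → ℂ) :
    weilWindowForm a (∑ n ∈ s, c n • chi a n) - weilPoleForm (∑ n ∈ s, c n • chi a n) +
        (∑ k ∈ weilPrimeIndex a, ((χ (k : ZMod q)).re - 1) * ((Λ k : ℝ) / Real.sqrt k) *
          (weilIncrement (∑ n ∈ s, c n • chi a n) (Real.log k) -
            2 * ∫ x, ‖(∑ n ∈ s, c n • chi a n) x‖ ^ 2)) +
        Real.log q * ∫ x, ‖(∑ n ∈ s, c n • chi a n) x‖ ^ 2 =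
      ∑ n ∈ s, ∑ m ∈ s, (conj (c n) * c m).re * twistedGramCoeff χ a n m := by
  rw [weilWindowForm_sum_smul_chi_eq_gramCoeff ha, weilPoleForm_sum_smul_chi ha,
    integral_norm_sq_sum_smul_chi' ha]
  have hK : ∀ k ∈ weilPrimeIndex a, weilIncrement (∑ n ∈ s, c n • chi a n) (Real.log k) =
      ∑ n ∈ s, ∑ m ∈ s, (conj (c n) * c m).re * incrCoeff a (Real.log k) n m := by
    intro k hk
    rw [weilIncrement_sum_smul_chi ha s c (Real.log_natCast_nonneg k) (mem_weilPrimeIndex.1 hk).le]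
    rfl
  have hP : (∑ n ∈ s, ∑ m ∈ s, (conj (c n) * c m).re *
      ((-1 : ℝ) ^ (n + m) * (4 / a) * (Real.exp (a / 2) - Real.exp (-(a / 2))) ^ 2 *
        (1 - 4 * (π * n / a) * (π * m / a)) / ((1 + 4 * (π * n / a) ^ 2) * (1 + 4 * (π * m / a) ^ 2)))) =
      ∑ n ∈ s, ∑ m ∈ s, (conj (c n) * c m).re * polarCoeff a n m := rfl
  have hKsum : (∑ k ∈ weilPrimeIndex a, ((χ (k : ZMod q)).re - 1) * ((Λ k : ℝ) / Real.sqrt k) *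
      (weilIncrement (∑ n ∈ s, c n • chi a n) (Real.log k) -
        2 * ∑ n ∈ s, ∑ m ∈ s, (conj (c n) * c m).re * (if n = m then (1 : ℝ) else 0))) =
      ∑ n ∈ s, ∑ m ∈ s, (conj (c n) * c m).re *
        ∑ k ∈ weilPrimeIndex a, ((χ (k : ZMod q)).re - 1) * ((Λ k : ℝ) / Real.sqrt k) *
          (incrCoeff a (Real.log k) n m - if n = m then 2 else 0) := by
    rw [pair_sum']
    refine Finset.sum_congr rfl fun k hk ↦ ?_
    rw [hK k hk, ← pair_const_mul' s c (2 : ℝ), ← pair_sub', ← pair_const_mul']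
    refine Finset.sum_congr rfl fun n _ ↦ Finset.sum_congr rfl fun m _ ↦ ?_
    split_ifs <;> ring
  have hQ : Real.log q * (∑ n ∈ s, ∑ m ∈ s, (conj (c n) * c m).re * (if n = m then (1 : ℝ) else 0)) =
      ∑ n ∈ s, ∑ m ∈ s, (conj (c n) * c m).re * (if n = m then Real.log q else 0) := by
    rw [← pair_const_mul']
    refine Finset.sum_congr rfl fun n _ ↦ Finset.sum_congr rfl fun m _ ↦ ?_
    split_ifs <;> ring
  rw [hP, hKsum, hQ, ← pair_sub', ← pair_add', ← pair_add']
  rfl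

end Summit.Ventures.WeilGRH

end
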